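import Mathlib
import Literature.NumberTheory.GaloisRepresentations.AbsGaloisOuterConj
import Literature.NumberTheory.GaloisRepresentations.SatakeFamilyOfFramedGaloisRep
import Literature.NumberTheory.GaloisRepresentations.HeckeCharacterGaloisAvatarProofs
import Literature.NumberTheory.GaloisRepresentations.HeckeCharacterOfRayClass
import Literature.NumberTheory.GaloisRepresentations.FramedRepTwist
import Literature.NumberTheory.Automorphic.SelfdualGL3AdjointLiftProofs
import Literature.NumberTheory.Automorphic.AutomorphicRepsGLSatakeFlathProofs
import Literature.NumberTheory.Automorphic.ChebotarevArtinRepHolds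
import Summits.Langlands.Langlands.Theorems.TwistUnpackaging.Negative.TwistSeparationOrder

/-!
# Admissibility of all but at most one power of the twist — stub `stub_admissiblePowers` of line
kummer-chebotarev-separating-twists (crux TwistUnpackaging, stmt-Langlands-10903)

Stub B of the checked skeleton of the crux
`Summit.Langlands.Langlands.Theses.QuadraticWindow.TwistUnpackaging`: the Chebotarev-free
pigeonhole.  Let `π` be a cuspidal automorphic representation of `GL_n` over the number field `F`,
`τ` an automorphism of `F` acting on the finite places, `p > n` a prime, `c v` a `p`-th root of
unity for `v` off a finite set `Q`, and `e j` rank-one framed Galois representations with Frobenius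
value `c v ^ j` at every `v ∉ Q`.  If `π` is not `τ`-invariant (at cofinitely-frequently many `w`
the Satake parameters at `w` and `τ • w` differ — the crux's `hnti`), then for all exponents
`0 < j < p` but at most one the twist `π ⊗ ψ^j` is *robustly* not `τ`-invariant, i.e. the
admissibility clause of the controlled family holds verbatim.

Proof (elementary; multisets and the cofinite filter, no density theorem).  If two exponents
`j₁ ≠ j₂` below `p` both failed, then at almost every `w` the failure of `j` reads
`Sat(π, τ•w) · c(τ•w)^j = Sat(π, w) · c(w)^j` (`j = j₁, j₂`).  Pick such a `w` with `w, τ•w ∉ Q`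
at which moreover `Sat(π, τ•w) ≠ Sat(π, w)` (`hnti` is frequent, the other conditions eventual).
With `r = c(w) / c(τ•w)` (a `p`-th root of unity) the multiset `α = Sat(π, w)` — `n < p` non-zero
entries — satisfies `α · r^{j₁} = α · r^{j₂}`, so `α` is stable under the `p`-th root of unity
`ζ = r^{j₂-j₁}`; a non-trivial `ζ` has order `p` and would put the `p` distinct points `x₀ ζ^k`
in `α`, impossible, so `ζ = 1`, hence `r = 1` (`0 < j₂ - j₁ < p`), i.e. `c(w) = c(τ•w)`, and
then `Sat(π, τ•w) = Sat(π, w)` — contradiction.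

Sources: the combinatorial core is the orbit-counting argument of
`Summit.Langlands.Langlands.Theorems.TwistUnpackaging.Negative.separates_of` (same programme);
`AutomorphicRepData.HasSatakeParamAt.card_eq` / `.zero_not_mem` supply `card α = n` and `0 ∉ α`.
-/

set_option linter.dupNamespace false -- project-wide option (lakefile weak.linter.dupNamespace); `Summit.Langlands.Langlands` is the mandated namespace

open Literature.NumberTheory.GaloisRepresentations Literature.NumberTheory.Automorphic
open IsDedekindDomain NumberField Filter

namespace Summit.Langlands.Langlands.Theorems.TwistUnpackaging.KummerChebotarev

/-- A `p`-th root of unity (`p` prime) killed by an exponent `d` with `0 < d < p` is `1`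
(its order divides `gcd(p, d) = 1`). [folklore] -/
theorem eq_one_of_pow_eq_one_of_lt {p d : ℕ} (hp : p.Prime) {r : ℂ} (hr : r ^ p = 1)
    (hd : 0 < d) (hdp : d < p) (h : r ^ d = 1) : r = 1 := by
  by_contra hr1
  haveI : Fact p.Prime := ⟨hp⟩
  have hord : orderOf r = p := orderOf_eq_prime hr hr1
  have hdvd : p ∣ d := hord ▸ orderOf_dvd_of_pow_eq_one h
  exact absurd (Nat.le_of_dvd hd hdvd) (not_le.mpr hdp)

/-- A non-empty multiset of fewer than `p` non-zero complex numbers is not stable under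
multiplication by a non-trivial `p`-th root of unity `ζ` (`p` prime): with `x₀` it would contain
the `p` distinct points `x₀ ζ^k`, `k < p = orderOf ζ` (the orbit count of
`Negative.separates_of`). [folklore] -/
theorem eq_one_of_map_mul_eq_self {p : ℕ} (hp : p.Prime) {ζ : ℂ} (hζ : ζ ^ p = 1)
    {α : Multiset ℂ} (hcard : Multiset.card α < p) (h0 : (0 : ℂ) ∉ α) (hne : α ≠ 0)
    (hstab : α.map (fun x ↦ x * ζ) = α) : ζ = 1 := by
  by_contra hζ1
  haveI : Fact p.Prime := ⟨hp⟩
  have hord : orderOf ζ = p := orderOf_eq_prime hζ hζ1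
  obtain ⟨x₀, hx₀⟩ := Multiset.exists_mem_of_ne_zero hne
  have hx₀0 : x₀ ≠ 0 := fun h => h0 (h ▸ hx₀)
  have hmem : ∀ k : ℕ, x₀ * ζ ^ k ∈ α := by
    intro k
    induction k with
    | zero =>
      rw [pow_zero, mul_one]
      exact hx₀
    | succ k ih =>
      rw [pow_succ, ← mul_assoc, ← hstab]
      exact Multiset.mem_map.2 ⟨x₀ * ζ ^ k, ih, rfl⟩
  have hinj : Set.InjOn (fun k : ℕ => x₀ * ζ ^ k) ↑(Finset.range p) := by
    intro i hi j hj h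
    have h' : ζ ^ i = ζ ^ j := mul_left_cancel₀ hx₀0 h
    refine pow_injOn_Iio_orderOf (x := ζ) ?_ ?_ h'
    · simpa [hord] using hi
    · simpa [hord] using hj
  have hsub : (Finset.range p).image (fun k : ℕ => x₀ * ζ ^ k) ⊆ α.toFinset := by
    intro z hz
    obtain ⟨k, -, rfl⟩ := Finset.mem_image.1 hz
    exact Multiset.mem_toFinset.2 (hmem k)
  have h1 := Finset.card_le_card hsub
  rw [Finset.card_image_of_injOn hinj, Finset.card_range] at h1
  have h2 := Multiset.toFinset_card_le α
  omega

/-- **Two exponents pin the parameter.** If `x, y` are `p`-th roots of unity (`p` prime),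
`j₁ ≠ j₂` are exponents below `p`, `α` is a multiset of fewer than `p` non-zero complex numbers
and `β · y^{j} = α · x^{j}` (entrywise scaling) for `j = j₁` and `j = j₂`, then `β = α`:
`α` is stable under `(x/y)^{j₂-j₁}`, which is therefore `1` (`eq_one_of_map_mul_eq_self`), so
`x = y` (`eq_one_of_pow_eq_one_of_lt`) and the scaling cancels. [folklore] -/
theorem eq_of_map_mul_pow_eq {p : ℕ} (hp : p.Prime) {x y : ℂ} (hx : x ^ p = 1) (hy : y ^ p = 1)
    {j₁ j₂ : ℕ} (hj₁ : j₁ < p) (hj₂ : j₂ < p) (hne : j₁ ≠ j₂) {α β : Multiset ℂ}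
    (hcard : Multiset.card α < p) (h0 : (0 : ℂ) ∉ α)
    (E1 : β.map (fun b ↦ b * y ^ j₁) = α.map (fun a ↦ a * x ^ j₁))
    (E2 : β.map (fun b ↦ b * y ^ j₂) = α.map (fun a ↦ a * x ^ j₂)) : β = α := by
  -- reduce to `j₁ < j₂`
  wlog hlt : j₁ < j₂ generalizing j₁ j₂
  · exact this hj₂ hj₁ hne.symm E2 E1 (by omega)
  have hx0 : x ≠ 0 := by
    rintro rfl
    rw [zero_pow hp.ne_zero] at hx
    exact zero_ne_one hx
  have hy0 : y ≠ 0 := by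
    rintro rfl
    rw [zero_pow hp.ne_zero] at hy
    exact zero_ne_one hy
  -- rescale: `β = α · (x/y)^j`
  have key : ∀ j : ℕ, β.map (fun b ↦ b * y ^ j) = α.map (fun a ↦ a * x ^ j) →
      β = α.map (fun a ↦ a * (x / y) ^ j) := by
    intro j hj
    have h1 : (β.map (fun b ↦ b * y ^ j)).map (fun b ↦ b * (y ^ j)⁻¹) = β := by
      rw [Multiset.map_map]
      have hc : ((fun b : ℂ ↦ b * (y ^ j)⁻¹) ∘ fun b ↦ b * y ^ j) = id := by
        funext b
        simp only [Function.comp_apply, id_eq]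
        rw [mul_inv_cancel_right₀ (pow_ne_zero j hy0)]
      rw [hc, Multiset.map_id]
    have h2 : (α.map (fun a ↦ a * x ^ j)).map (fun b ↦ b * (y ^ j)⁻¹) =
        α.map (fun a ↦ a * (x / y) ^ j) := by
      rw [Multiset.map_map]
      congr 1
      funext a
      simp only [Function.comp_apply]
      rw [div_pow, div_eq_mul_inv, mul_assoc]
    rw [← h1, hj, h2]
  have hb1 := key j₁ E1
  have hb2 := key j₂ E2
  set r : ℂ := x / y with hr
  have hrp : r ^ p = 1 := by rw [hr, div_pow, hx, hy, div_one]
  have hr0 : r ≠ 0 := div_ne_zero hx0 hy0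
  -- `α` is stable under `ζ := r ^ (j₂ - j₁)`
  have hstab : α.map (fun a ↦ a * r ^ (j₂ - j₁)) = α := by
    have e : (α.map (fun a ↦ a * r ^ (j₂ - j₁))).map (fun a ↦ a * r ^ j₁) =
        α.map (fun a ↦ a * r ^ j₂) := by
      rw [Multiset.map_map]
      congr 1
      funext a
      simp only [Function.comp_apply]
      rw [mul_assoc, ← pow_add, Nat.sub_add_cancel hlt.le]
    have hinj : Function.Injective (Multiset.map (fun a : ℂ ↦ a * r ^ j₁)) :=
      Multiset.map_injective (mul_left_injective₀ (pow_ne_zero _ hr0))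
    apply hinj
    rw [e, ← hb2, ← hb1]
  by_cases hα : α = 0
  · rw [hb1, hα, Multiset.map_zero]
  have hζ : (r ^ (j₂ - j₁)) ^ p = 1 := by
    rw [← pow_mul, mul_comm, pow_mul, hrp, one_pow]
  have hζ1 : r ^ (j₂ - j₁) = 1 := eq_one_of_map_mul_eq_self hp hζ hcard h0 hα hstab
  have hr1 : r = 1 :=
    eq_one_of_pow_eq_one_of_lt hp hrp (Nat.sub_pos_of_lt hlt)
      (lt_of_le_of_lt (Nat.sub_le _ _) hj₂) hζ1
  rw [hb1, hr1]
  simp only [one_pow, mul_one, Multiset.map_id']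

/-- **Stub B — admissibility of all but at most one power (Chebotarev-free pigeonhole).**  With
values `c v` (`p`-th roots of unity off the finite `Q`, `p` a prime `> n`) and rank-one avatars
`e j` with Frobenius value `c v ^ j` off `Q`, and `π` not `τ`-invariant (`hnti`, verbatim from
the crux): for all `j ∈ (0, p)` but at most one, `π ⊗ ψ^j` is robustly not `τ`-invariant — the
admissibility clause of the controlled family, verbatim.  Proof: if `j₁ ≠ j₂` both failed, then
at almost every `w` the failure gives `Sat(π,τw) · c_{τw}^j = Sat(π,w) · c_w^j` for `j = j₁, j₂`
(instantiate the Frobenius values `c_w^j`, `c_{τw}^j` supplied by the avatars at `w, τ•w ∉ Q`);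
at a `w` where moreover `Sat(π,τw) ≠ Sat(π,w)` (`hnti` frequent, the rest eventual:
`Set.Finite.eventually_cofinite_notMem`, injectivity of `w ↦ τ • w`) this contradicts
`eq_of_map_mul_pow_eq` (`card Sat(π,w) = n < p`, `0 ∉ Sat(π,w)` by
`HasSatakeParamAt.card_eq` / `.zero_not_mem`). [folklore] -/
theorem stub_admissiblePowers :
    ∀ (F₀ F : Type) [Field F₀] [NumberField F₀] [Field F] [NumberField F] [Algebra F₀ F]
      (τ : F ≃ₐ[F₀] F) (n : ℕ) (hcpt : isCompact_glFiniteIntegralLevel n F)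
      (π : CuspidalAutomorphicRepData n F hcpt)
      (p : ℕ) (Q : Set (HeightOneSpectrum (𝓞 F))) (c : HeightOneSpectrum (𝓞 F) → ℂ)
      (e : ℕ → FramedGaloisRep F ℂ 1),
      p.Prime → n < p → Q.Finite →
      (∀ v ∉ Q, c v ^ p = 1) →
      (∀ j : ℕ, ∀ v ∉ Q, (e j).HasFrobCharpolyAt v (Polynomial.X - Polynomial.C (c v ^ j))) →
      (∃ᶠ w in Filter.cofinite, ∃ α β : Multiset ℂ,
        π.1.HasSatakeParamAt w α ∧ π.1.HasSatakeParamAt (τ • w) β ∧ β ≠ α) →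
    ∃ j₀ : ℕ, ∀ j : ℕ, 0 < j → j < p → j ≠ j₀ →
      ∃ᶠ w in Filter.cofinite, ∃ (α β : Multiset ℂ) (a a' : ℂ),
        π.1.HasSatakeParamAt w α ∧ π.1.HasSatakeParamAt (τ • w) β ∧
        (e j).HasFrobCharpolyAt w (Polynomial.X - Polynomial.C a) ∧
        (e j).HasFrobCharpolyAt (τ • w) (Polynomial.X - Polynomial.C a') ∧
        β.map (fun b ↦ b * a') ≠ α.map (fun x ↦ x * a) := by
  intro F₀ F _ _ _ _ _ τ n hcpt π p Q c e hp hnp hQ hc he hnti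
  by_contra hall
  push Not at hall
  -- two distinct failing exponents `j₁, j₂ < p`
  obtain ⟨j₁, -, hj₁p, -, hj₁⟩ := hall 0
  obtain ⟨j₂, -, hj₂p, hne, hj₂⟩ := hall j₁
  -- good places: `w, τ • w ∉ Q`
  have hQc : ∀ᶠ w in Filter.cofinite, w ∉ Q := hQ.eventually_cofinite_notMem
  have hτQc : ∀ᶠ w in Filter.cofinite, τ • w ∉ Q :=
    (MulAction.injective τ).tendsto_cofinite.eventually hQc
  -- a good place where both exponents fail and `Sat(π, τ•w) ≠ Sat(π, w)`
  obtain ⟨w, ⟨α, β, hα, hβ, hβα⟩, ⟨hwQ, hτwQ⟩, h₁w, h₂w⟩ :=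
    (hnti.and_eventually ((hQc.and hτQc).and (hj₁.and hj₂))).exists
  have E1 : β.map (fun b ↦ b * c (τ • w) ^ j₁) = α.map (fun x ↦ x * c w ^ j₁) :=
    h₁w α β (c w ^ j₁) (c (τ • w) ^ j₁) hα hβ (he j₁ w hwQ) (he j₁ (τ • w) hτwQ)
  have E2 : β.map (fun b ↦ b * c (τ • w) ^ j₂) = α.map (fun x ↦ x * c w ^ j₂) :=
    h₂w α β (c w ^ j₂) (c (τ • w) ^ j₂) hα hβ (he j₂ w hwQ) (he j₂ (τ • w) hτwQ)
  exact hβα (eq_of_map_mul_pow_eq hp (hc w hwQ) (hc (τ • w) hτwQ) hj₁p hj₂p (Ne.symm hne)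
    (hα.card_eq.trans_lt hnp) hα.zero_not_mem E1 E2)

end Summit.Langlands.Langlands.Theorems.TwistUnpackaging.KummerChebotarev
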